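import Summits.NavierStokesRegularity.FluidComputer.PalasekTowerBurgersLayerBounds
import Summits.NavierStokesRegularity.FluidComputer.PalasekTowerHeredityWitnessCalibration

/-!
# The level-1 READ-OUT of the wide register as a Burgers vortex LAYER, I: the card's objects
# (`readout`, `coreLoop`, the `Prop`s `LayerReadoutWide` / `SheetBandUniform`) and the loop's geometry

Cell `ns-blowup`, seat `ns-blowup-ecbridge-4` (g6; D-0074 GROUP C «BRIDGE SUPPORT», stub `first_episode` of
the crux `EpisodeBase` = item stmt-NavierStokesRegularity-19179 of the route `PalasekTowerBreakdown`, line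
`slot`; supports / evidence only, nothing claimed). The crux idea «orthogonal-seed-contact-strain» (planner
seat `ns-plan-lens-profile` g0, 19179 evidence #47/#48, 2026-08-26) reads the grown level of the episode
`0 → 1` not as a round Burgers VORTEX (which overshoots the velocity ceiling at large `k`,
`palasekTowerBreakdown_burgers_eventually_overshoot`) but as a Burgers vortex LAYER
`burgersLayer γ ν ΔU = (−γx₀, V(x₀), γx₂)`, `V(s) = (ΔU/√π) ∫₀^{κ s} e^{−t²} dt`, `κ = (γ/2ν)^{1/2}`
(`Literature.Analysis.FluidPDE.BurgersVortexLayer`). This file restates VERBATIM from the card's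
`Sketch.lean` (sha16 4a3cc81f515d704a) its objects — the design point `(γ_c, ν, ΔU) = (260000, 1, 6400)`,
the read-out profile `readout = burgersLayer γ_c 1 ΔU`, the core-ledger loop `coreLoop` (horizontal circle
of radius `1/N₁` about the origin) — and its two `Prop`s `LayerReadoutWide` (the four level-1 readouts of
a rigid wide schedule: velocity floor `Y₁` at `(1/120, 0, 0)`, strain floor `A₁` at the origin, ceiling
`(5/3)Y₁` on the slab `x₀² + x₂² ≤ (1/80)²`, core-ledger floor `N₁^{β−2}` on the loop) and
`SheetBandUniform` (the `k`-uniform gradient floor of the layer `ΔU = (12/5)Y_{k+1}`, `γ = (6/5)N_{k+1}²`),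
and proves the loop's ADMISSIBILITY for `CoreLedger`: it is `C¹`, closed, of radius exactly `1/N₁`
(inside the closed ball of radius `1/N₁` about the origin) and of speed `2π/N₁ ≤ 8π/N₁`, with velocity
`coreLoopDeriv`; plus the elementary constants used downstream (`√π ≤ 2`, `√π ≤ 1.775`,
`κ = √130000 ∈ [360.5, 361]`, `1/446 ≤ 1/N₁ ≤ 1/445`). BOTH `Prop`s ARE PROVED in the companion file
`PalasekTowerBurgersLayerReadoutFloors.lean` (`layerReadoutWide`, `sheetBandUniform`); the calculus on the
layer is `PalasekTowerBurgersLayerBounds.lean`.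

LABEL: MODEL-side register vocabulary on an exact, steady, infinite-energy profile. WHAT THIS IS NOT: not
Navier–Stokes evidence — nothing is asserted about any registered stage, about the card's HOST (the head-on
dipole collision and its contact strain `γ_c`, item (4) of the card, is untouched), about `FirstEpisodeD`,
`RungG 1`, `EpisodeBaseG` or blow-up. References: J. M. Burgers, Adv. Appl. Mech. 1 (1948) 171–199;
S. Palasek, arXiv:2605.13827 §3–§4 (rates and register); the card
`HOME/lens-profile/idea-orthogonal-seed-contact-strain.md` (sha16 9fa53b274b27c215).
-/

noncomputable section
namespace Summit.NavierStokesRegularity.FluidComputer.PalasekTowerClayBridge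

open Set MeasureTheory Filter Topology Function Real intervalIntegral
open scoped ContDiff
open Literature.Analysis.FluidPDE

namespace OrthogonalSeed

/-! ## §1 The design point of the card and its two `Prop`s (verbatim from `Sketch.lean`) -/

/-- contact strain of the design point (units `ν = 1`, ball radius `1`) — the card's `γ_c = 2.6e5`. [folklore] -/
def γc : ℝ := 260000

/-- velocity jump across the compacted seed layer at readout — the card's `ΔU = 6400`. [folklore] -/
def ΔUc : ℝ := 6400

/-- the level-1 read-out profile of the card: the Burgers vortex layer at `ν = 1`. [folklore] -/
def readout : EuclideanSpace ℝ (Fin 3) → EuclideanSpace ℝ (Fin 3) :=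
  burgersLayer γc 1 ΔUc

/-- the core-ledger loop of the card: the horizontal circle of radius `1/N₁` about the origin,
parametrised by `[0, 1]`. [folklore] -/
def coreLoop (s : ℝ) : EuclideanSpace ℝ (Fin 3) :=
  !₂[(1 / TowerRates.wide.N 1) * Real.cos (2 * π * s), (1 / TowerRates.wide.N 1) * Real.sin (2 * π * s), 0]

/-- **First lemma of the card (`LayerReadoutWide`), restated verbatim.** The Burgers layer at
`(γ, ΔU) = (2.6e5, 6400)`, `ν = 1`, meets the level-1 velocity floor, strain floor, slab ceiling and
core-ledger floor of the rigid wide register. PROVED in `PalasekTowerBurgersLayerReadoutFloors.lean`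
(`OrthogonalSeed.layerReadoutWide`). [folklore] -/
def LayerReadoutWide : Prop :=
  TowerRates.wide.Y 1 ≤ ‖readout !₂[(1 : ℝ) / 120, 0, 0]‖ ∧
  TowerRates.wide.A 1 ≤ ‖fderiv ℝ readout 0‖ ∧
  (∀ x : EuclideanSpace ℝ (Fin 3), x 0 ^ 2 + x 2 ^ 2 ≤ (1 / 80) ^ 2 →
      ‖readout x‖ ≤ 5 / 3 * TowerRates.wide.Y 1) ∧
  TowerRates.wide.N 1 ^ (TowerRates.wide.β - 2) ≤ circulation readout coreLoop

/-- **Sheet band, k-uniform (`SheetBandUniform`), restated verbatim.** For every level `k`, the Burgers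
layer with jump `ΔU = (12/5)·Y_{k+1}` in the strain `γ = (6/5)·N_{k+1}²` at `ν = 1` meets the
level-`(k+1)` strain floor at the origin. PROVED in `PalasekTowerBurgersLayerReadoutFloors.lean`
(`OrthogonalSeed.sheetBandUniform`). [folklore] -/
def SheetBandUniform : Prop :=
  ∀ k : ℕ, TowerRates.wide.A (k + 1) ≤
    ‖fderiv ℝ (burgersLayer (6 / 5 * TowerRates.wide.N (k + 1) ^ 2) 1 (12 / 5 * TowerRates.wide.Y (k + 1))) 0‖

/-! ## §2 Elementary constants -/

/-- `√π ≤ 2`. [folklore] -/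
theorem sqrt_pi_le_two : Real.sqrt Real.pi ≤ 2 := by
  rw [show (2 : ℝ) = Real.sqrt (2 ^ 2) by rw [Real.sqrt_sq (by norm_num)]]
  exact Real.sqrt_le_sqrt (by linarith [Real.pi_le_four])

/-- `√π ≤ 1.775` (`π < 3.15 < 1.775²`). [folklore] -/
theorem sqrt_pi_le : Real.sqrt Real.pi ≤ 1.775 := by
  rw [show (1.775 : ℝ) = Real.sqrt (1.775 ^ 2) by rw [Real.sqrt_sq (by norm_num)]]
  exact Real.sqrt_le_sqrt (by linarith [Real.pi_lt_d2])

/-- The layer rate of the design point: `κ = √130000 ∈ [360.5, 361]`. [folklore] -/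
theorem rate_bounds : 360.5 ≤ burgersLayerRate γc 1 ∧ burgersLayerRate γc 1 ≤ 361 := by
  have hκ : burgersLayerRate γc 1 = Real.sqrt 130000 := by
    simp only [burgersLayerRate, γc]; norm_num
  rw [hκ]
  constructor
  · rw [show (360.5 : ℝ) = Real.sqrt (360.5 ^ 2) by rw [Real.sqrt_sq (by norm_num)]]
    exact Real.sqrt_le_sqrt (by norm_num)
  · rw [show (361 : ℝ) = Real.sqrt (361 ^ 2) by rw [Real.sqrt_sq (by norm_num)]]
    exact Real.sqrt_le_sqrt (by norm_num)

/-- `1/446 ≤ 1/N₁ ≤ 1/445`. [folklore] -/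
theorem inv_N_one_bounds :
    (1 : ℝ) / 446 ≤ 1 / TowerRates.wide.N 1 ∧ 1 / TowerRates.wide.N 1 ≤ 1 / 445 := by
  obtain ⟨h1, h2⟩ := TowerRates.wide_N_one_bounds
  have hN : 0 < TowerRates.wide.N 1 := by linarith
  exact ⟨one_div_le_one_div_of_le hN h2.le, one_div_le_one_div_of_le (by norm_num) h1.le⟩

/-- The squared norm of a vector of `ℝ³` given by its three coordinates. [folklore] -/
theorem norm_vec_sq (a b c : ℝ) :
    ‖(!₂[a, b, c] : EuclideanSpace ℝ (Fin 3))‖ ^ 2 = a ^ 2 + b ^ 2 + c ^ 2 := by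
  rw [EuclideanSpace.norm_sq_eq]
  simp [Fin.sum_univ_three]

/-! ## §3 The core-ledger loop: admissibility for `CoreLedger` -/

/-- The loop in `smul` form: `γ(s) = (ρ cos 2πs)·e₀ + (ρ sin 2πs)·e₁`, `ρ = 1/N₁`. [folklore] -/
theorem coreLoop_eq (s : ℝ) : coreLoop s =
    ((1 / TowerRates.wide.N 1) * Real.cos (2 * π * s)) • (!₂[(1 : ℝ), 0, 0] : EuclideanSpace ℝ (Fin 3)) +
    ((1 / TowerRates.wide.N 1) * Real.sin (2 * π * s)) • (!₂[(0 : ℝ), 1, 0] : EuclideanSpace ℝ (Fin 3)) := by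
  ext i
  fin_cases i <;> simp [coreLoop]

/-- The velocity of the loop: `γ′(s) = (−2πρ sin 2πs, 2πρ cos 2πs, 0)`. [folklore] -/
def coreLoopDeriv (s : ℝ) : EuclideanSpace ℝ (Fin 3) :=
  !₂[-(2 * π * (1 / TowerRates.wide.N 1)) * Real.sin (2 * π * s),
    (2 * π * (1 / TowerRates.wide.N 1)) * Real.cos (2 * π * s), 0]

/-- The loop velocity in `smul` form. [folklore] -/
theorem coreLoopDeriv_eq (s : ℝ) : coreLoopDeriv s =
    (-(2 * π * (1 / TowerRates.wide.N 1)) * Real.sin (2 * π * s)) •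
      (!₂[(1 : ℝ), 0, 0] : EuclideanSpace ℝ (Fin 3)) +
    ((2 * π * (1 / TowerRates.wide.N 1)) * Real.cos (2 * π * s)) •
      (!₂[(0 : ℝ), 1, 0] : EuclideanSpace ℝ (Fin 3)) := by
  ext i
  fin_cases i <;> simp [coreLoopDeriv]

/-- The loop is differentiable with derivative `coreLoopDeriv`. [folklore] -/
theorem hasDerivAt_coreLoop (s : ℝ) : HasDerivAt coreLoop (coreLoopDeriv s) s := by
  have h2π : HasDerivAt (fun s : ℝ => 2 * π * s) (2 * π) s := by
    simpa using (hasDerivAt_id s).const_mul (2 * π)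
  have hc : HasDerivAt (fun s : ℝ => (1 / TowerRates.wide.N 1) * Real.cos (2 * π * s))
      ((1 / TowerRates.wide.N 1) * (-Real.sin (2 * π * s) * (2 * π))) s := (h2π.cos).const_mul _
  have hsn : HasDerivAt (fun s : ℝ => (1 / TowerRates.wide.N 1) * Real.sin (2 * π * s))
      ((1 / TowerRates.wide.N 1) * (Real.cos (2 * π * s) * (2 * π))) s := (h2π.sin).const_mul _
  have h := (hc.smul_const (!₂[(1 : ℝ), 0, 0] : EuclideanSpace ℝ (Fin 3))).add
    (hsn.smul_const (!₂[(0 : ℝ), 1, 0] : EuclideanSpace ℝ (Fin 3)))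
  have hfun : coreLoop = fun s : ℝ =>
      ((1 / TowerRates.wide.N 1) * Real.cos (2 * π * s)) • (!₂[(1 : ℝ), 0, 0] : EuclideanSpace ℝ (Fin 3)) +
      ((1 / TowerRates.wide.N 1) * Real.sin (2 * π * s)) • (!₂[(0 : ℝ), 1, 0] : EuclideanSpace ℝ (Fin 3)) := by
    funext s; exact coreLoop_eq s
  have hval : coreLoopDeriv s =
      ((1 / TowerRates.wide.N 1) * (-Real.sin (2 * π * s) * (2 * π))) •
        (!₂[(1 : ℝ), 0, 0] : EuclideanSpace ℝ (Fin 3)) +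
      ((1 / TowerRates.wide.N 1) * (Real.cos (2 * π * s) * (2 * π))) •
        (!₂[(0 : ℝ), 1, 0] : EuclideanSpace ℝ (Fin 3)) := by
    rw [coreLoopDeriv_eq,
      show -(2 * π * (1 / TowerRates.wide.N 1)) * Real.sin (2 * π * s) =
        (1 / TowerRates.wide.N 1) * (-Real.sin (2 * π * s) * (2 * π)) by ring,
      show (2 * π * (1 / TowerRates.wide.N 1)) * Real.cos (2 * π * s) =
        (1 / TowerRates.wide.N 1) * (Real.cos (2 * π * s) * (2 * π)) by ring]
  rw [hfun, hval]
  exact h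

/-- `deriv γ = γ′`. [folklore] -/
theorem deriv_coreLoop : deriv coreLoop = coreLoopDeriv :=
  funext fun s => (hasDerivAt_coreLoop s).deriv

/-- The loop is `C¹` (indeed smooth). [folklore] -/
theorem contDiff_coreLoop : ContDiff ℝ 1 coreLoop := by
  have hfun : coreLoop = fun s : ℝ =>
      ((1 / TowerRates.wide.N 1) * Real.cos (2 * π * s)) • (!₂[(1 : ℝ), 0, 0] : EuclideanSpace ℝ (Fin 3)) +
      ((1 / TowerRates.wide.N 1) * Real.sin (2 * π * s)) • (!₂[(0 : ℝ), 1, 0] : EuclideanSpace ℝ (Fin 3)) := by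
    funext s; exact coreLoop_eq s
  rw [hfun]
  fun_prop

/-- The loop velocity is continuous. [folklore] -/
theorem continuous_coreLoopDeriv : Continuous coreLoopDeriv := by
  have hfun : coreLoopDeriv = fun s : ℝ =>
      (-(2 * π * (1 / TowerRates.wide.N 1)) * Real.sin (2 * π * s)) •
        (!₂[(1 : ℝ), 0, 0] : EuclideanSpace ℝ (Fin 3)) +
      ((2 * π * (1 / TowerRates.wide.N 1)) * Real.cos (2 * π * s)) •
        (!₂[(0 : ℝ), 1, 0] : EuclideanSpace ℝ (Fin 3)) := by
    funext s; exact coreLoopDeriv_eq s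
  rw [hfun]
  fun_prop

/-- The loop is closed. [folklore] -/
theorem coreLoop_closed : coreLoop 0 = coreLoop 1 := by
  ext i
  fin_cases i <;> simp [coreLoop]

/-- The loop stays on the circle of radius `1/N₁`: `‖γ(s)‖ = 1/N₁`. [folklore] -/
theorem norm_coreLoop (s : ℝ) : ‖coreLoop s‖ = 1 / TowerRates.wide.N 1 := by
  have hρ : 0 ≤ 1 / TowerRates.wide.N 1 := le_trans (by norm_num) inv_N_one_bounds.1
  have hsq : ‖coreLoop s‖ ^ 2 = (1 / TowerRates.wide.N 1) ^ 2 := by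
    rw [coreLoop, norm_vec_sq]
    have := Real.cos_sq_add_sin_sq (2 * π * s)
    calc (1 / TowerRates.wide.N 1 * Real.cos (2 * π * s)) ^ 2 +
          (1 / TowerRates.wide.N 1 * Real.sin (2 * π * s)) ^ 2 + 0 ^ 2
        = (1 / TowerRates.wide.N 1) ^ 2 * (Real.cos (2 * π * s) ^ 2 + Real.sin (2 * π * s) ^ 2) := by
          ring
      _ = (1 / TowerRates.wide.N 1) ^ 2 := by rw [this, mul_one]
  exact (sq_eq_sq₀ (norm_nonneg _) hρ).1 hsq

/-- The loop lies in the closed ball of radius `1/N₁` about the origin. [folklore] -/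
theorem coreLoop_mem (s : ℝ) : coreLoop s ∈ Metric.closedBall (0 : EuclideanSpace ℝ (Fin 3))
    (1 / TowerRates.wide.N 1) := by
  rw [Metric.mem_closedBall, dist_zero_right, norm_coreLoop]

/-- The speed of the loop: `‖γ′(s)‖ = 2π/N₁`. [folklore] -/
theorem norm_deriv_coreLoop (s : ℝ) : ‖deriv coreLoop s‖ = 2 * π / TowerRates.wide.N 1 := by
  obtain ⟨hN, -⟩ := TowerRates.wide_N_one_bounds
  have hρ : 0 ≤ 2 * π / TowerRates.wide.N 1 := by positivity
  rw [deriv_coreLoop]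
  have hsq : ‖coreLoopDeriv s‖ ^ 2 = (2 * π / TowerRates.wide.N 1) ^ 2 := by
    rw [coreLoopDeriv, norm_vec_sq]
    have := Real.cos_sq_add_sin_sq (2 * π * s)
    calc (-(2 * π * (1 / TowerRates.wide.N 1)) * Real.sin (2 * π * s)) ^ 2 +
          (2 * π * (1 / TowerRates.wide.N 1) * Real.cos (2 * π * s)) ^ 2 + 0 ^ 2
        = (2 * π / TowerRates.wide.N 1) ^ 2 * (Real.cos (2 * π * s) ^ 2 + Real.sin (2 * π * s) ^ 2) := by
          ring
      _ = (2 * π / TowerRates.wide.N 1) ^ 2 := by rw [this, mul_one]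
  exact (sq_eq_sq₀ (norm_nonneg _) hρ).1 hsq

/-- The speed of the loop is admissible for the core ledger: `‖γ′(s)‖ ≤ 8π/N₁`. [folklore] -/
theorem norm_deriv_coreLoop_le (s : ℝ) : ‖deriv coreLoop s‖ ≤ 8 * π / TowerRates.wide.N 1 := by
  obtain ⟨hN, -⟩ := TowerRates.wide_N_one_bounds
  rw [norm_deriv_coreLoop]
  exact div_le_div_of_nonneg_right (by nlinarith [Real.pi_pos]) (by linarith)

end OrthogonalSeed

end Summit.NavierStokesRegularity.FluidComputer.PalasekTowerClayBridge

end
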